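/-
HONEST FRAMING: systematic search; no irrationality claim unless certified.
-/
import Summits.KontsevichZagierPeriods.Zeta5Search.WedgeDictionaryBridge
import HarnessLib

/-!
# Certificate kit for the terminal-template programme: relation instances in numeral form

HONEST FRAMING: systematic search; no irrationality claim unless certified.
OUR work (Summit side; cell `pub-zeta5`, planner gen-1 g18, 2026-08-21; memo `pub-zeta5-gen-1/D2-TERMINAL-g17.md` §2, §4).

Shared boilerplate of the kernel renderings of the programme's exact certificates (base points, layers, two-parameter templates,
tops, anchoring).  Everything here is elementary algebra over the hypotheses `Cell*` / `Dict*` of `WedgeDictionaryThreeTerm` /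
`WedgeDictionaryBridge`; nothing analytic, nothing about irrationality.
* `defect a j = I(a) − (Q(a)θ − 4P̂_d(a,j)ζ(2) − 2P_d(a,j))`, so `ExplicitPQAt a j ↔ defect a j = 0`.
* The STAR / PENCIL / BRIDGE families as relations among defects with NUMERAL coefficients: the slot indices, the lattice moves and
  the values of the coefficient functions are bundled into ONE decidable hypothesis, discharged by `decide` in the certificate files
  (`star`, `pencil`, `bridge` for concrete points).
* Two-parameter affine families of points `pt v u w m t = v + m•u + t•w` (`m t : ℕ`): `b(·)` is additive (`bOfA_add`), every
  coefficient function is a product of two affine forms in `(m, t)` whose integer coefficients are computed from `(v, u, w)`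
  (`starF`, `fanF`, `pencilBaseF`, …), and the region hypotheses propagate from the base point `v` along directions of admissible
  slopes (`region_pt`) — again decidable data (`star2`, `pencil2`, `bridge2`).
* Identification of a point from its dual coordinates (`eq_of_bOfA`, `eq_pt`; the map `a ↦ b(a)` is unimodular). [folklore]
-/

noncomputable section

open Finset

namespace Summit.KontsevichZagierPeriods.Zeta5Search.WedgeDictionary

open Summit.KontsevichZagierPeriods.Zeta5Search.DualSeries
open Literature.NumberTheory.Irrationality.BrownZudilin2022 (vwpDual bOfA Converges convergenceForms cellularIntegral QOf)
open Literature.NumberTheory.Transcendental (zetaValue)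

namespace CertKit

/-- Parameter vectors `a ∈ ℤ⁸` of the generalised cellular integrals. [folklore] -/
abbrev Vec := Fin 8 → ℤ

/-! ## 1. Defects -/

/-- The defect of `explicitPQ` at `(a, j)`: `I(a) − (Q(a)θ − 4P̂_d(a,j)ζ(2) − 2P_d(a,j))`. [folklore] -/
def defect (a : Vec) (j : ℕ) : ℝ :=
  cellularIntegral a - ((QOf a : ℝ) * (2 * zetaValue 5 + 4 * zetaValue 3 * zetaValue 2) -
    4 * (dictPhat a j : ℝ) * zetaValue 2 - 2 * (dictP a j : ℝ))

/-- `defect a j = 0 ↔ ExplicitPQAt a j`. [folklore] -/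
theorem defect_eq_zero_iff (a : Vec) (j : ℕ) : defect a j = 0 ↔ ExplicitPQAt a j := by
  unfold defect ExplicitPQAt; constructor <;> intro h <;> linarith

/-- `ExplicitPQAt` gives a vanishing defect. [folklore] -/
theorem defect_of_at {a : Vec} {j : ℕ} (h : ExplicitPQAt a j) : defect a j = 0 :=
  (defect_eq_zero_iff a j).mpr h

/-- A vanishing defect gives `ExplicitPQAt`. [folklore] -/
theorem at_of_defect {a : Vec} {j : ℕ} (h : defect a j = 0) : ExplicitPQAt a j :=
  (defect_eq_zero_iff a j).mp h

/-- `D · defect = 0` with `D > 0` gives `ExplicitPQAt` (templates with a cleared denominator `D`). [folklore] -/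
theorem at_of_mul_defect {a : Vec} {j : ℕ} {D : ℝ} (hD : 0 < D) (h : D * defect a j = 0) : ExplicitPQAt a j :=
  (defect_eq_zero_iff a j).mp ((mul_eq_zero.mp h).resolve_left hD.ne')

/-- A three-term relation among the integrals plus the matching dictionary identities give the same relation among
the defects. [folklore] -/
theorem defect_rel3 {α β γ : ℚ} {a₀ a₁ a₂ : Vec} {j₀ j₁ j₂ : ℕ} (cel : ThreeTermRel α β γ a₀ a₁ a₂)
    (dic : DictThreeTerm α β γ a₀ a₁ a₂ j₀ j₁ j₂) :
    (α : ℝ) * defect a₀ j₀ + (β : ℝ) * defect a₁ j₁ + (γ : ℝ) * defect a₂ j₂ = 0 := by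
  unfold ThreeTermRel at cel
  unfold DictThreeTerm at dic
  obtain ⟨dq, dph, dp⟩ := dic
  have dq' : _ := (Rat.cast_injective (α := ℝ)).eq_iff.mpr dq
  have dph' : _ := (Rat.cast_injective (α := ℝ)).eq_iff.mpr dph
  have dp' : _ := (Rat.cast_injective (α := ℝ)).eq_iff.mpr dp
  push_cast at dq' dph' dp'
  unfold defect
  linear_combination cel - (2 * zetaValue 5 + 4 * zetaValue 3 * zetaValue 2) * dq' + (4 * zetaValue 2) * dph' + 2 * dp'

/-- The four-term (BRIDGE) analogue of `defect_rel3`. [folklore] -/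
theorem defect_rel4 {α β γ δ : ℚ} {a₀ a₁ a₂ a₃ : Vec} {j₀ j₁ j₂ j₃ : ℕ} (cel : FourTermRel α β γ δ a₀ a₁ a₂ a₃)
    (dic : DictFourTerm α β γ δ a₀ a₁ a₂ a₃ j₀ j₁ j₂ j₃) :
    (α : ℝ) * defect a₀ j₀ + (β : ℝ) * defect a₁ j₁ + (γ : ℝ) * defect a₂ j₂ + (δ : ℝ) * defect a₃ j₃ = 0 := by
  unfold FourTermRel at cel
  unfold DictFourTerm at dic
  obtain ⟨dq, dph, dp⟩ := dic
  have dq' : _ := (Rat.cast_injective (α := ℝ)).eq_iff.mpr dq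
  have dph' : _ := (Rat.cast_injective (α := ℝ)).eq_iff.mpr dph
  have dp' : _ := (Rat.cast_injective (α := ℝ)).eq_iff.mpr dp
  push_cast at dq' dph' dp'
  unfold defect
  linear_combination cel - (2 * zetaValue 5 + 4 * zetaValue 3 * zetaValue 2) * dq' + (4 * zetaValue 2) * dph' + 2 * dp'

/-! ## 2. Decidability of the region hypotheses and the families at concrete points -/

/-- `RegionHyp a j` is decidable (evaluated by `decide` at concrete points). [folklore] -/
instance instDecidableRegionHyp (a : Vec) (j : ℕ) : Decidable (RegionHyp a j) := by
  unfold RegionHyp; infer_instance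

/-- **STAR instance, numeral form** (concrete points): slot data, moves, coefficient values and the region hypotheses of the
three points are decided at once. [folklore] -/
theorem star (hcS : CellStar) (hdS : DictStar) (a a₁ a₂ : Vec) (i k j₀ j₁ j₂ : ℕ) (κ c₁ c₂ : ℤ)
    (h : ((i ∈ Icc 1 7 ∧ k ∈ Icc 1 7 ∧ i ≠ k) ∧ (a + slotDown k = a₁ ∧ a + slotDown i = a₂) ∧
      (starKappa (bOfA a) i k = κ ∧ fanCoeff (bOfA a) k = c₁ ∧ fanCoeff (bOfA a) i = c₂)) ∧
      (RegionHyp a j₀ ∧ RegionHyp a₁ j₁ ∧ RegionHyp a₂ j₂)) :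
    (κ : ℝ) * defect a j₀ - (c₁ : ℝ) * defect a₁ j₁ + (c₂ : ℝ) * defect a₂ j₂ = 0 := by
  obtain ⟨⟨⟨hi, hk, hik⟩, ⟨rfl, rfl⟩, ⟨rfl, rfl, rfl⟩⟩, g₀, g₁, g₂⟩ := h
  have e := defect_rel3 (hcS a i k j₀ j₁ j₂ hi hk hik g₀ g₁ g₂) (hdS a i k j₀ j₁ j₂ hi hk hik g₀ g₁ g₂)
  push_cast at e
  linear_combination e

/-- **PENCIL instance, numeral form** (concrete points). [folklore] -/
theorem pencil (hcP : CellPencil) (hdP : DictPencil) (a a₁ a₂ : Vec) (i j₀ j₁ j₂ : ℕ) (κ c₁ c₂ : ℤ)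
    (h : (i ∈ Icc 1 7 ∧ (a + dsUp = a₁ ∧ a + dsUp + slotDown i = a₂) ∧
      (pencilBase (bOfA a) = κ ∧ pencilApex (bOfA a) i = c₁ ∧ fanCoeff (bOfA (a + dsUp)) i = c₂)) ∧
      (RegionHyp a j₀ ∧ RegionHyp a₁ j₁ ∧ RegionHyp a₂ j₂)) :
    (κ : ℝ) * defect a j₀ + (c₁ : ℝ) * defect a₁ j₁ + (c₂ : ℝ) * defect a₂ j₂ = 0 := by
  obtain ⟨⟨hi, ⟨rfl, rfl⟩, ⟨rfl, rfl, rfl⟩⟩, g₀, g₁, g₂⟩ := h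
  have e := defect_rel3 (hcP a i j₀ j₁ j₂ hi g₀ g₁ g₂) (hdP a i j₀ j₁ j₂ hi g₀ g₁ g₂)
  push_cast at e
  linear_combination e

/-- **BRIDGE instance, numeral form** (concrete points). [folklore] -/
theorem bridge (hcB : CellBridge) (hdB : DictBridge) (a a₁ a₂ a₃ : Vec) (j₀ j₁ j₂ j₃ : ℕ) (κ c₁ c₂ c₃ : ℤ)
    (h : ((a - slotDown 7 = a₁ ∧ a + halfUp457 = a₂ ∧ a + dsUp = a₃) ∧
      (bridgeBase (bOfA a) = κ ∧ bridgeSlot (bOfA a) = c₁ ∧ bridgeHalf (bOfA a) = c₂ ∧ bridgeApex (bOfA a) = c₃)) ∧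
      (RegionHyp a j₀ ∧ RegionHyp a₁ j₁ ∧ RegionHyp a₂ j₂ ∧ RegionHyp a₃ j₃)) :
    (κ : ℝ) * defect a j₀ + (c₁ : ℝ) * defect a₁ j₁ + (c₂ : ℝ) * defect a₂ j₂ + (c₃ : ℝ) * defect a₃ j₃ = 0 := by
  obtain ⟨⟨⟨rfl, rfl, rfl⟩, ⟨rfl, rfl, rfl, rfl⟩⟩, g₀, g₁, g₂, g₃⟩ := h
  have e := defect_rel4 (hcB a j₀ j₁ j₂ j₃ g₀ g₁ g₂ g₃) (hdB a j₀ j₁ j₂ j₃ g₀ g₁ g₂ g₃)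
  push_cast at e
  linear_combination e

/-! ## 3. Identification of a point from its dual coordinates -/

/-- The inverse of `a ↦ b(a)` in closed form: `a` is recovered from `b(a)`. [folklore] -/
theorem eq_vec_of_bOfA {a : Vec} {p₀ p₁ p₂ p₃ p₄ p₅ p₆ p₇ : ℤ}
    (h0 : bOfA a 0 = p₀) (h1 : bOfA a 1 = p₁) (h2 : bOfA a 2 = p₂) (h3 : bOfA a 3 = p₃)
    (h4 : bOfA a 4 = p₄) (h5 : bOfA a 5 = p₅) (h6 : bOfA a 6 = p₆) (h7 : bOfA a 7 = p₇) :
    a = ![p₀ - p₁ - p₂, p₂, p₀ - p₂ - p₃, p₃, p₀ - p₃ - p₄, p₀ - p₅ - p₆, p₀ - p₆ - p₇, p₀ - p₃ - p₅] := by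
  simp only [bOfA] at h0 h1 h2 h3 h4 h5 h6 h7
  ext n
  fin_cases n <;> simp <;> omega

/-- **Point identification, numeral form** (concrete centre `c`): `b(a) = p` forces `a = c` once `c` is checked to be the
preimage of `p` (decidable). [folklore] -/
theorem eq_of_bOfA {a : Vec} (c : Vec) {p₀ p₁ p₂ p₃ p₄ p₅ p₆ p₇ : ℤ}
    (hc : c = ![p₀ - p₁ - p₂, p₂, p₀ - p₂ - p₃, p₃, p₀ - p₃ - p₄, p₀ - p₅ - p₆, p₀ - p₆ - p₇, p₀ - p₃ - p₅])
    (h0 : bOfA a 0 = p₀) (h1 : bOfA a 1 = p₁) (h2 : bOfA a 2 = p₂) (h3 : bOfA a 3 = p₃)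
    (h4 : bOfA a 4 = p₄) (h5 : bOfA a 5 = p₅) (h6 : bOfA a 6 = p₆) (h7 : bOfA a 7 = p₇) : a = c := by
  rw [hc]; exact eq_vec_of_bOfA h0 h1 h2 h3 h4 h5 h6 h7

/-- Two points with the same dual coordinates are equal. [folklore] -/
theorem eq_of_bOfA_eq {a c : Vec} (h : ∀ n, n ≤ 7 → bOfA a n = bOfA c n) : a = c := by
  rw [eq_vec_of_bOfA (a := a) rfl rfl rfl rfl rfl rfl rfl rfl, eq_vec_of_bOfA (a := c) rfl rfl rfl rfl rfl rfl rfl rfl]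
  simp only [h 0 (by norm_num), h 1 (by norm_num), h 2 (by norm_num), h 3 (by norm_num), h 4 (by norm_num),
    h 5 (by norm_num), h 6 (by norm_num), h 7 (by norm_num)]

/-! ## 4. Two-parameter affine families of points -/

/-- The affine family `v + m•u + t•w` of parameter vectors (`m, t ∈ ℕ`). [folklore] -/
def pt (v u w : Vec) (m t : ℕ) : Vec := v + (m : ℤ) • u + (t : ℤ) • w

/-- `b(·)` is additive. [folklore] -/
theorem bOfA_add (a u : Vec) (n : ℕ) (hn : n ≤ 7) : bOfA (a + u) n = bOfA a n + bOfA u n := by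
  interval_cases n <;> simp only [bOfA, Pi.add_apply] <;> ring

/-- An affine form `c + p·m + q·t` in the parameters, as its coefficient triple `(c, p, q)`. [folklore] -/
abbrev Aff := ℤ × ℤ × ℤ

/-- Evaluation of an affine form at `(m, t)`. [folklore] -/
def ev (f : Aff) (m t : ℕ) : ℤ := f.1 + f.2.1 * m + f.2.2 * t

/-- `ev` is additive. [folklore] -/
theorem ev_add (f g : Aff) (m t : ℕ) : ev (f + g) m t = ev f m t + ev g m t := by
  simp only [ev, Prod.fst_add, Prod.snd_add]; ring

/-- `ev` respects subtraction. [folklore] -/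
theorem ev_sub (f g : Aff) (m t : ℕ) : ev (f - g) m t = ev f m t - ev g m t := by
  simp only [ev, Prod.fst_sub, Prod.snd_sub]; ring

/-- `ev` respects negation. [folklore] -/
theorem ev_neg (f : Aff) (m t : ℕ) : ev (-f) m t = -ev f m t := by
  simp only [ev, Prod.fst_neg, Prod.snd_neg]; ring

/-- The constant form `1`. [folklore] -/
theorem ev_one (m t : ℕ) : ev (1, 0, 0) m t = 1 := by simp [ev]

/-- The dual coordinate `b_n` along the family `pt v u w`, as an affine form. [folklore] -/
def bAff (v u w : Vec) (n : ℕ) : Aff := (bOfA v n, bOfA u n, bOfA w n)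

/-- `b_n(pt v u w m t) = b_n(v) + m·b_n(u) + t·b_n(w)`. [folklore] -/
theorem bOfA_pt (v u w : Vec) (m t : ℕ) (n : ℕ) (hn : n ≤ 7) : bOfA (pt v u w m t) n = ev (bAff v u w n) m t := by
  interval_cases n <;> simp only [bOfA, pt, ev, bAff, Pi.add_apply, Pi.smul_apply, smul_eq_mul] <;> ring

/-- The family at `(0, 0)` is the base point. [folklore] -/
theorem pt_zero (v u w : Vec) : pt v u w 0 0 = v := by
  funext n; simp [pt]

/-- One step in `m`. [folklore] -/
theorem pt_succ_m (v u w : Vec) (m t : ℕ) : pt v u w (m + 1) t = pt v u w m t + u := by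
  funext n; simp only [pt, Pi.add_apply, Pi.smul_apply, smul_eq_mul]; push_cast; ring

/-- One step in `t`. [folklore] -/
theorem pt_succ_t (v u w : Vec) (m t : ℕ) : pt v u w m (t + 1) = pt v u w m t + w := by
  funext n; simp only [pt, Pi.add_apply, Pi.smul_apply, smul_eq_mul]; push_cast; ring

/-- Translating the base point translates the family. [folklore] -/
theorem pt_add {v d v' : Vec} (h : v + d = v') (u w : Vec) (m t : ℕ) : pt v u w m t + d = pt v' u w m t := by
  subst h; funext n; simp only [pt, Pi.add_apply, Pi.smul_apply, smul_eq_mul]; ring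

/-- Translating the base point translates the family (subtraction). [folklore] -/
theorem pt_sub {v d v' : Vec} (h : v - d = v') (u w : Vec) (m t : ℕ) : pt v u w m t - d = pt v' u w m t := by
  subst h; funext n; simp only [pt, Pi.add_apply, Pi.sub_apply, Pi.smul_apply, smul_eq_mul]; ring

/-- The levels of two members of parallel families compare as the levels of their base points. [folklore] -/
theorem lt0_pt {v' v : Vec} (u w : Vec) (h : bOfA v' 0 < bOfA v 0) (m t : ℕ) :
    bOfA (pt v' u w m t) 0 < bOfA (pt v u w m t) 0 := by
  rw [bOfA_pt v' u w m t 0 (by norm_num), bOfA_pt v u w m t 0 (by norm_num)]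
  simp only [ev, bAff]
  linarith

/-- **Point identification along a family, numeral form**: `b(a) = b(v) + m·b(u) + t·b(w)` (given by numerals checked against
`(v, u, w)` by `decide`) forces `a = pt v u w m t`. [folklore] -/
theorem eq_pt {a v u w : Vec} {m t : ℕ}
    (p₀ q₀ r₀ p₁ q₁ r₁ p₂ q₂ r₂ p₃ q₃ r₃ p₄ q₄ r₄ p₅ q₅ r₅ p₆ q₆ r₆ p₇ q₇ r₇ : ℤ)
    (hb : bAff v u w 0 = (p₀, q₀, r₀) ∧ bAff v u w 1 = (p₁, q₁, r₁) ∧ bAff v u w 2 = (p₂, q₂, r₂) ∧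
      bAff v u w 3 = (p₃, q₃, r₃) ∧ bAff v u w 4 = (p₄, q₄, r₄) ∧ bAff v u w 5 = (p₅, q₅, r₅) ∧
      bAff v u w 6 = (p₆, q₆, r₆) ∧ bAff v u w 7 = (p₇, q₇, r₇))
    (h0 : bOfA a 0 = p₀ + q₀ * m + r₀ * t) (h1 : bOfA a 1 = p₁ + q₁ * m + r₁ * t)
    (h2 : bOfA a 2 = p₂ + q₂ * m + r₂ * t) (h3 : bOfA a 3 = p₃ + q₃ * m + r₃ * t)
    (h4 : bOfA a 4 = p₄ + q₄ * m + r₄ * t) (h5 : bOfA a 5 = p₅ + q₅ * m + r₅ * t)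
    (h6 : bOfA a 6 = p₆ + q₆ * m + r₆ * t) (h7 : bOfA a 7 = p₇ + q₇ * m + r₇ * t) : a = pt v u w m t := by
  obtain ⟨e0, e1, e2, e3, e4, e5, e6, e7⟩ := hb
  refine eq_of_bOfA_eq fun n hn => ?_
  interval_cases n
  · rw [h0, bOfA_pt v u w m t 0 (by norm_num), e0]; rfl
  · rw [h1, bOfA_pt v u w m t 1 (by norm_num), e1]; rfl
  · rw [h2, bOfA_pt v u w m t 2 (by norm_num), e2]; rfl
  · rw [h3, bOfA_pt v u w m t 3 (by norm_num), e3]; rfl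
  · rw [h4, bOfA_pt v u w m t 4 (by norm_num), e4]; rfl
  · rw [h5, bOfA_pt v u w m t 5 (by norm_num), e5]; rfl
  · rw [h6, bOfA_pt v u w m t 6 (by norm_num), e6]; rfl
  · rw [h7, bOfA_pt v u w m t 7 (by norm_num), e7]; rfl

/-! ## 5. Region hypotheses along a family -/

/-- Admissible slopes of a direction `u` for the partner `j`: every region form is non-decreasing along `u`. [folklore] -/
def Slopes (u : Vec) (j : ℕ) : Prop :=
  (∀ x ∈ convergenceForms u, 0 ≤ x) ∧ (∀ i ∈ Icc 1 7, 0 ≤ bOfA u i ∧ 2 * bOfA u i ≤ bOfA u 0) ∧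
    0 ≤ dOf (bOfA u) ∧ 2 * bOfA u j ≤ bOfA u 0

/-- `Slopes u j` is decidable. [folklore] -/
instance instDecidableSlopes (u : Vec) (j : ℕ) : Decidable (Slopes u j) := by
  unfold Slopes; infer_instance

/-- A bounded quantifier over the slots `1, …, 7` is a sevenfold conjunction. [folklore] -/
theorem forall_Icc17 {P : ℕ → Prop} : (∀ i ∈ Icc 1 7, P i) ↔ (P 1 ∧ P 2 ∧ P 3 ∧ P 4 ∧ P 5 ∧ P 6 ∧ P 7) := by
  constructor
  · intro h
    exact ⟨h 1 (by simp), h 2 (by simp), h 3 (by simp), h 4 (by simp), h 5 (by simp), h 6 (by simp), h 7 (by simp)⟩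
  · rintro ⟨h1, h2, h3, h4, h5, h6, h7⟩ i hi
    simp only [mem_Icc] at hi
    obtain ⟨hi1, hi7⟩ := hi
    interval_cases i <;> assumption

/-- The region is closed under translation by a direction of admissible slopes. [folklore] -/
theorem regionHyp_add {a u : Vec} {j : ℕ} (ha : RegionHyp a j) (hu : Slopes u j) : RegionHyp (a + u) j := by
  obtain ⟨hj, hc, hbox, hd, hp⟩ := ha
  obtain ⟨uc, ubox, ud, up⟩ := hu
  have hj7 : j ≤ 7 := (mem_Icc.mp hj).2
  rw [forall_Icc17] at hbox ubox
  refine ⟨hj, ?_, ?_, ?_, ?_⟩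
  · simp only [Converges, convergenceForms, List.forall_mem_cons, List.not_mem_nil, false_implies, implies_true,
      and_true, Pi.add_apply] at hc uc ⊢
    omega
  · rw [forall_Icc17]
    simp only [bOfA_add a u 0 (by norm_num), bOfA_add a u 1 (by norm_num), bOfA_add a u 2 (by norm_num),
      bOfA_add a u 3 (by norm_num), bOfA_add a u 4 (by norm_num), bOfA_add a u 5 (by norm_num),
      bOfA_add a u 6 (by norm_num), bOfA_add a u 7 (by norm_num)]
    omega
  · rw [dOf_bOfA] at hd ud ⊢
    simp only [Pi.add_apply]
    omega
  · rw [bOfA_add a u j hj7, bOfA_add a u 0 (by norm_num)]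
    omega

/-- **Region hypotheses along a family, decidable form**: the base point is a region point and both directions have
admissible slopes. [folklore] -/
theorem region_pt {v u w : Vec} {j : ℕ} (h : RegionHyp v j ∧ Slopes u j ∧ Slopes w j) (m t : ℕ) :
    RegionHyp (pt v u w m t) j := by
  obtain ⟨hv, hu, hw⟩ := h
  induction t with
  | zero =>
    induction m with
    | zero => rw [pt_zero]; exact hv
    | succ m ih => rw [pt_succ_m]; exact regionHyp_add ih hu
  | succ t ih => rw [pt_succ_t]; exact regionHyp_add ih hw

end CertKit

end Summit.KontsevichZagierPeriods.Zeta5Search.WedgeDictionary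

end
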